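import Summits.QuantumFields.BalabanUV.Beta.GAN24.SlavedSummandLetterDriftRows
import Summits.QuantumFields.BalabanUV.Beta.GAN24.CombBlockCommutatorStepLetter

/-!
# `BalabanUV.Beta.GAN24.CombBlockCommutatorStepLetterDrift` — binder row G-an2-4 ∕ (CONV-C), TRANSFER-III (the (α-0) chain at row D1's literal of record (III′)), link L8b:
# **THE DRIFT TWIN OF `CombBlockCommutatorStepLetter` — THE ONE-STEP DIFFERENCE ROWS `hEd₁ ∕ hEd₂` OF THE SLAVED `e3OfK` SUMMAND TABLES AT `ε = 1`, UNIFORMLY IN THE LEVEL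
# WITH A GEOMETRIC RATE, FOR ANY KERNEL ∕ TABLE FAMILIES WITH UNIFORM AND CAUCHY UNIT ROWS AND THE BLOCK GENERATOR AT ANY SCALE `ξ`; THE COMB-CHART INSTANCE AT an1's RECORD
# MODULO THE S-SLOT ROWS AND TWO SCALAR ROWS** — the slot ∕ (III′) twin of road-P2 g45's (E) `BlockCommutatorStepLetterDrift` (PART 2 over leaf-03 g66's PART 1
# `SlavedSummandLetterDriftRows`), whose rows are stated for `K♮ᴱ_l = unitK_l (coDressKBmAt ρ Lc (KInvStep Lc l))`, `S′_l = unitS_l (SpureRecAt … ρ … l)`, `ξ = ½`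
# (G-an2-4 CRUX TEAM (2), leaf prover `b2b-balaban-gan24-formalise-leaf-01`, gen 82 — crew GAN's kept leaf prover; the rows produced are EXACTLY the displayed binder `hEd` of MY
# `CombSlavedDivRowsOfWardLetters` ∕ `hEd₁ ∕ hEd₂` of MY g80 PART 6′ ∕ 6b′ `CombHalfMemberSlavedDivergenceDrift{,Snd}` at `ε = 1`; first refusal road-P2 honoured by the journal
# INTENT; no existing file touched)

NOT IN PRINT; OUR BOOKKEEPING ([folklore] composition BY NAME — road-P2 g45's §1 texts token for token with `(K♮ᴱ, S′, ½) ↦ (unitK ∘ K, unitS ∘ S, ξ)` generic; §2 plugs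
leaf-02's (III′) K-slot and «S′ from S»; 0 `def`, 0 cited facts, 0 `def … : Prop`, 0 sorry).  HONEST FRAMING (cell contract, verbatim): «discharging `BetaPertH` makes
Bałaban's UV stability UNCONDITIONAL — a real constructive-QFT result; it is NOT the continuum limit and NOT the Clay problem.»  HONEST DEPENDENCY (verbatim): «continuum YM on
T⁴ ⇐ BetaPertH ∧ nine spine estimates (0/9 proved); BetaPertH ⇐ (D1) ∧ (D4) ∧ CAP+tail; G-an2-4 gates asym, D1 and NE2/3/4.»

WHAT (in-block root `ρ = toSite r`, unit scalars `sfStep ∕ smStep`, block generators `X p = diagK (ξ • Σ_{v ∈ box} legInd ρ (Lc • p + v))`):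
* §1 (generic `d`, `1 ≤ Lc`, ANY `K : ℕ → MKer`, `S : ℕ → …`) `driftRows_level_smul` (ONE level: PART 1's `driftRows_of_rows` at the pair `(l, l+1)`, the level-`l+1` scalar
  moved to level `l` by `hq`) and the SOCKET **`exists_evenRowsDrift_uniform_of_rows_smul`**: from `hG ∕ hGall` (uniform ∧ Cauchy unit rows of the kernels `unitK_j (K j)`),
  `hS ∕ hSall` (the same for the tables `unitS_j (S j)`), `hcH`, `hq`: `∃ CEd θE δE, 0 ≤ θE < 1 ∧ 0 < δE ∧ ∀ l, hEd₁(l) ∧ hEd₂(l)` with rate `CEd·θE^l`, `θE := max θK θS`.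
* §2 (`d = 3`, `2 ≤ Lc`, an1's record `symTablesAn1S2 3 Lc cΛt`) **`exists_comb_evenRowsDrift_uniform_three`** — §1 at `K := GcombSh Lc` (leaf-02 g77's K-slot
  `KSlotCombChart.kSlotCombSh_holds`, both rows, hypothesis-free) and `S := SpureCombOf (symTablesAn1S2 3 Lc cΛt) cE cVH cΛ` («S′Shape» ∧ «S′Drift» ⟸ (hS, hSall) of
  `ScombOf …`, leaf-02 g79): the drift rows for ALL levels MODULO (hS, hSall) AND `hcH`, `hq` ONLY.
READING (zero weight): at (III′) the S-slot rows of `ScombOf` are the S′-campaign's (road-P2 g56's M.104 reduces them to six contact letters) and the two scalar rows are the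
pin's (at `cE₂ = Lc⁸` the product `(sf_l·sm_l)⁻¹·(cH l)⁻¹` is `l`-free — p2 g46's `CombPinLockScalar` at chart (II)) — DISPLAYED here.  CONDITIONAL on the displayed rows;
asserts NO bound on Bałaban's tables beyond them; discharges NOTHING of `hcelld` ∕ `hcell` ∕ (Q-L) ∕ (C) ∕ one S-∕W-slot row; the (III′) campaign is NOT asked (an2 W-4
l.64553); NEVER «G-an2-4 closed» as (CONV-C); NOT D1, NOT `BetaPertH`, NOT continuum, NOT Clay; not in print.  2026-08-25.
-/

noncomputable section

open Finset
open scoped BigOperators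
open Literature.MathematicalPhysics.QuantumFieldTheory
open Literature.MathematicalPhysics.QuantumFieldTheory.Balaban1983to89
open Literature.MathematicalPhysics.QuantumFieldTheory.Balaban1983to89.Beta
open B12Sec2to5 (l1 l1_nonneg)
open ExpKernelCalculus (MKer Decays Zl comp Zl_nonneg)
open OneStepResolventKernel (Fib LocStencil)
open AffineAveraging (box toSite)
open BalabanCompositeJets (LocStencil₂)
open Summit.QuantumFields.BalabanUV.Beta.BorderedHessian (diagK)
open Summit.QuantumFields.BalabanUV.Beta.HessKerDressedUnits (unitK unitS)
open Summit.QuantumFields.BalabanUV.Beta.SpineRooted (e3OfK)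
open Summit.QuantumFields.BalabanUV.Beta.AveragingWardRootedStencils (legInd)
open Summit.QuantumFields.BalabanUV.Beta.CombChartStepJets (GcombSh ScombOf SpureCombOf)
open Summit.QuantumFields.BalabanUV.Beta.SymSecondOrderTablesAn1 (symTablesAn1S2)
open Summit.QuantumFields.BalabanUV.Beta.GAN24.CombesThomas (sfStep smStep)
open Summit.QuantumFields.BalabanUV.Beta.GAN24.WSlotCauchyOfShapes (locStencil₂_le_mono)
open Summit.QuantumFields.BalabanUV.Beta.GAN24.SlavedSummandLetterRows (evenLetterTable_eq_commFactor)
open Summit.QuantumFields.BalabanUV.Beta.GAN24.SlavedSummandLetterDriftRows (driftRows_of_rows)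
open Summit.QuantumFields.BalabanUV.Beta.GAN24.CombBlockCommutatorStepLetter (abs_blockLegInd_smul_le blockLegInd_smul_support)
open Summit.QuantumFields.BalabanUV.Beta.GAN24.KSlotCombChart (kSlotCombSh_holds)
open Summit.QuantumFields.BalabanUV.Beta.GAN24.CombSpureRowsOfSRows (exists_spureCombOf_rows_three_of_scombOf_rows)

namespace Summit.QuantumFields.BalabanUV.Beta.GAN24.CombBlockCommutatorStepLetterDrift

variable {d : ℕ} {Lc : ℕ} [NeZero Lc] {r : Fin (d + 1) → ℕ}

/-! ## §1 The drift rows `hEd₁ ∕ hEd₂` at `ε = 1` for ANY kernel ∕ table families, generic `d` -/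

omit [NeZero Lc] in
/-- NOT IN PRINT; OUR BOOKKEEPING — A SOCKET, ONE LEVEL ([folklore] composition: leaf-03 g66's PART 1 `SlavedSummandLetterDriftRows.driftRows_of_rows` at the pair of levels
`(l, l + 1)` — `K := unitK_l (K l)`, `K′ := unitK_{l+1} (K (l+1))`, `F := unitS_l (S l)`, `F′ := unitS_{l+1} (S (l+1))`, `CD := cK·θK^l`, `CFd := cS·θS^l`; the factor form by
`evenLetterTable_eq_commFactor` at both levels, the scalar of level `l + 1` moved to level `l` by the DISPLAYED row `hq`; §1 of `CombBlockCommutatorStepLetter` for the block symbol at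
scale `ξ`; generic `d`, in-block root `r`, `1 ≤ Lc`; ANY families `K`, `S`).  **THE DRIFT ROWS `hEd₁ ∕ hEd₂` OF PART 6 ∕ 6b (and of MY g80 PART 6′ ∕ 6b′ at `K := GcombSh Lc`) AT
`ε = 1`, LEVEL `l`, with the level-`l` constant `2·|cout|·|q_l|·(3·cK·θK^l·C²·Cs + C³·cS·θS^l)·Ψ(ξ)`** (`q_l = (sf_l·sm_l)⁻¹·(cH l)⁻¹`) — road-P2 g45's `driftRows_level` with
`(K♮ᴱ, S′, ½) ↦ (unitK ∘ K, unitS ∘ S, ξ)` generic, text token for token.  Every displayed row is a HYPOTHESIS; asserts NO bound beyond them. -/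
theorem driftRows_level_smul (hLc : 1 ≤ Lc) (hr : r ∈ box (d + 1) Lc) (ξ cout : ℝ) (cH : ℕ → ℝ)
    (hq : ∀ l, (sfStep Lc (l + 1) * smStep d Lc (l + 1))⁻¹ * (cH (l + 1))⁻¹ = (sfStep Lc l * smStep d Lc l)⁻¹ * (cH l)⁻¹)
    {K : ℕ → MKer (d + 1) (Fib d)} {C cK θK δ : ℝ}
    (hG : ∀ j, Decays (unitK (sfStep Lc j) (smStep d Lc j) (K j)) C δ)
    (hGall : ∀ k j, Decays (unitK (sfStep Lc (k + j)) (smStep d Lc (k + j)) (K (k + j))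
        - unitK (sfStep Lc k) (smStep d Lc k) (K k)) (cK * θK ^ k) δ)
    (hδ : 0 < δ)
    {S : ℕ → Fin (d + 1) → (Fin (d + 1) → ℤ) → MKer (d + 1) (Fib d)}
    {Cs cS θS δs : ℝ} (hS : ∀ j, LocStencil (unitS (sfStep Lc j) (smStep d Lc j) (S j)) Cs δs)
    (hSall : ∀ k j, LocStencil (unitS (sfStep Lc (k + j)) (smStep d Lc (k + j)) (S (k + j))
        - unitS (sfStep Lc k) (smStep d Lc k) (S k)) (cS * θS ^ k) δs)
    (hδs : 0 < δs)
    (R R'' : ℕ → (Fin (d + 1) → ℤ) → Fin (d + 1) → (Fin (d + 1) → ℤ) → MKer (d + 1) (Fib d)) (l : ℕ) :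
      LocStencil₂ (fun (_ : Fin (d + 1)) (p : Fin (d + 1) → ℤ) (κ' : Fin (d + 1)) (u' : Fin (d + 1) → ℤ) =>
            cout • (e3OfK Lc (unitK (sfStep Lc (l + 1)) (smStep d Lc (l + 1)) (K (l + 1)))
                (fun κ' u' => (sfStep Lc (l + 1) * smStep d Lc (l + 1))⁻¹ • unitS (sfStep Lc (l + 1)) (smStep d Lc (l + 1))
                  (fun κ' u' => (cH (l + 1))⁻¹ • ((((1 : ℝ) + 1) / 2) • (comp (S (l + 1) κ' u')
                      (diagK (ξ • ∑ v ∈ box (d + 1) Lc, legInd (toSite r) ((Lc : ℤ) • p + toSite v)))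
                    - comp (diagK (ξ • ∑ v ∈ box (d + 1) Lc, legInd (toSite r) ((Lc : ℤ) • p + toSite v)))
                      (S (l + 1) κ' u')) + (((1 : ℝ) - 1) / 2) • R (l + 1) p κ' u')) κ' u') κ' u'
              + e3OfK Lc (unitK (sfStep Lc (l + 1)) (smStep d Lc (l + 1)) (K (l + 1)))
                (fun κ u => (sfStep Lc (l + 1) * smStep d Lc (l + 1))⁻¹ • unitS (sfStep Lc (l + 1)) (smStep d Lc (l + 1))
                  (fun κ u => (cH (l + 1))⁻¹ • ((((1 : ℝ) + 1) / 2) • (comp (S (l + 1) κ u)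
                      (diagK (ξ • ∑ v ∈ box (d + 1) Lc, legInd (toSite r) ((Lc : ℤ) • p + toSite v)))
                    - comp (diagK (ξ • ∑ v ∈ box (d + 1) Lc, legInd (toSite r) ((Lc : ℤ) • p + toSite v)))
                      (S (l + 1) κ u)) + (((1 : ℝ) - 1) / 2) • R'' (l + 1) p κ u)) κ u) κ' u')
        - (cout • (e3OfK Lc (unitK (sfStep Lc l) (smStep d Lc l) (K l))
              (fun κ' u' => (sfStep Lc l * smStep d Lc l)⁻¹ • unitS (sfStep Lc l) (smStep d Lc l)
                (fun κ' u' => (cH l)⁻¹ • ((((1 : ℝ) + 1) / 2) • (comp (S l κ' u')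
                    (diagK (ξ • ∑ v ∈ box (d + 1) Lc, legInd (toSite r) ((Lc : ℤ) • p + toSite v)))
                  - comp (diagK (ξ • ∑ v ∈ box (d + 1) Lc, legInd (toSite r) ((Lc : ℤ) • p + toSite v)))
                    (S l κ' u')) + (((1 : ℝ) - 1) / 2) • R l p κ' u')) κ' u') κ' u'
            + e3OfK Lc (unitK (sfStep Lc l) (smStep d Lc l) (K l))
              (fun κ u => (sfStep Lc l * smStep d Lc l)⁻¹ • unitS (sfStep Lc l) (smStep d Lc l)
                (fun κ u => (cH l)⁻¹ • ((((1 : ℝ) + 1) / 2) • (comp (S l κ u)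
                    (diagK (ξ • ∑ v ∈ box (d + 1) Lc, legInd (toSite r) ((Lc : ℤ) • p + toSite v)))
                  - comp (diagK (ξ • ∑ v ∈ box (d + 1) Lc, legInd (toSite r) ((Lc : ℤ) • p + toSite v)))
                    (S l κ u)) + (((1 : ℝ) - 1) / 2) • R'' l p κ u)) κ u) κ' u')))
      (2 * |cout| * |(sfStep Lc l * smStep d Lc l)⁻¹ * (cH l)⁻¹| * (3 * (cK * θK ^ l) * C * C * Cs + C * C * C * (cS * θS ^ l))
      * ((Fintype.card (Fib d) : ℝ) * (Fintype.card (Fib d) : ℝ)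
      * (2 * (|ξ| * (box (d + 1) Lc).card) * (((d + 1 : ℕ) : ℝ) * Zl (d + 1) (min δs δ / 2)) * Real.exp (min δs δ / 2 / 2 * (2 * (((d + 1 : ℕ) : ℝ) * Lc))))
      * Zl (d + 1) (min δs δ / 2 / 2 - min δs δ / 2 / 4) * Zl (d + 1) (min δs δ / 2 / 4 - min δs δ / 2 / 8))) (min δs δ / 2 / 8) ∧
      LocStencil₂ (fun (κ : Fin (d + 1)) (u : Fin (d + 1) → ℤ) (_ : Fin (d + 1)) (p : Fin (d + 1) → ℤ) =>
            cout • (e3OfK Lc (unitK (sfStep Lc (l + 1)) (smStep d Lc (l + 1)) (K (l + 1)))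
                (fun κ' u' => (sfStep Lc (l + 1) * smStep d Lc (l + 1))⁻¹ • unitS (sfStep Lc (l + 1)) (smStep d Lc (l + 1))
                  (fun κ' u' => (cH (l + 1))⁻¹ • ((((1 : ℝ) + 1) / 2) • (comp (S (l + 1) κ' u')
                      (diagK (ξ • ∑ v ∈ box (d + 1) Lc, legInd (toSite r) ((Lc : ℤ) • p + toSite v)))
                    - comp (diagK (ξ • ∑ v ∈ box (d + 1) Lc, legInd (toSite r) ((Lc : ℤ) • p + toSite v)))
                      (S (l + 1) κ' u')) + (((1 : ℝ) - 1) / 2) • R (l + 1) p κ' u')) κ' u') κ u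
              + e3OfK Lc (unitK (sfStep Lc (l + 1)) (smStep d Lc (l + 1)) (K (l + 1)))
                (fun κ u => (sfStep Lc (l + 1) * smStep d Lc (l + 1))⁻¹ • unitS (sfStep Lc (l + 1)) (smStep d Lc (l + 1))
                  (fun κ u => (cH (l + 1))⁻¹ • ((((1 : ℝ) + 1) / 2) • (comp (S (l + 1) κ u)
                      (diagK (ξ • ∑ v ∈ box (d + 1) Lc, legInd (toSite r) ((Lc : ℤ) • p + toSite v)))
                    - comp (diagK (ξ • ∑ v ∈ box (d + 1) Lc, legInd (toSite r) ((Lc : ℤ) • p + toSite v)))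
                      (S (l + 1) κ u)) + (((1 : ℝ) - 1) / 2) • R'' (l + 1) p κ u)) κ u) κ u)
        - (cout • (e3OfK Lc (unitK (sfStep Lc l) (smStep d Lc l) (K l))
              (fun κ' u' => (sfStep Lc l * smStep d Lc l)⁻¹ • unitS (sfStep Lc l) (smStep d Lc l)
                (fun κ' u' => (cH l)⁻¹ • ((((1 : ℝ) + 1) / 2) • (comp (S l κ' u')
                    (diagK (ξ • ∑ v ∈ box (d + 1) Lc, legInd (toSite r) ((Lc : ℤ) • p + toSite v)))
                  - comp (diagK (ξ • ∑ v ∈ box (d + 1) Lc, legInd (toSite r) ((Lc : ℤ) • p + toSite v)))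
                    (S l κ' u')) + (((1 : ℝ) - 1) / 2) • R l p κ' u')) κ' u') κ u
            + e3OfK Lc (unitK (sfStep Lc l) (smStep d Lc l) (K l))
              (fun κ u => (sfStep Lc l * smStep d Lc l)⁻¹ • unitS (sfStep Lc l) (smStep d Lc l)
                (fun κ u => (cH l)⁻¹ • ((((1 : ℝ) + 1) / 2) • (comp (S l κ u)
                    (diagK (ξ • ∑ v ∈ box (d + 1) Lc, legInd (toSite r) ((Lc : ℤ) • p + toSite v)))
                  - comp (diagK (ξ • ∑ v ∈ box (d + 1) Lc, legInd (toSite r) ((Lc : ℤ) • p + toSite v)))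
                    (S l κ u)) + (((1 : ℝ) - 1) / 2) • R'' l p κ u)) κ u) κ u)))
      (2 * |cout| * |(sfStep Lc l * smStep d Lc l)⁻¹ * (cH l)⁻¹| * (3 * (cK * θK ^ l) * C * C * Cs + C * C * C * (cS * θS ^ l))
      * ((Fintype.card (Fib d) : ℝ) * (Fintype.card (Fib d) : ℝ)
      * (2 * (|ξ| * (box (d + 1) Lc).card) * (((d + 1 : ℕ) : ℝ) * Zl (d + 1) (min δs δ / 2)) * Real.exp (min δs δ / 2 / 2 * (2 * (((d + 1 : ℕ) : ℝ) * Lc))))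
      * Zl (d + 1) (min δs δ / 2 / 2 - min δs δ / 2 / 4) * Zl (d + 1) (min δs δ / 2 / 4 - min δs δ / 2 / 8))) (min δs δ / 2 / 8) := by
  exact driftRows_of_rows (N := Lc) (CK := C) (CD := cK * θK ^ l) (δK := δ) (CF := Cs) (CFd := cS * θS ^ l) (δF := δs)
    (cg := |ξ| * (box (d + 1) Lc).card) (W := 2 * (((d + 1 : ℕ) : ℝ) * Lc))
    (K := unitK (sfStep Lc l) (smStep d Lc l) (K l))
    (K' := unitK (sfStep Lc (l + 1)) (smStep d Lc (l + 1)) (K (l + 1)))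
    (F := unitS (sfStep Lc l) (smStep d Lc l) (S l))
    (F' := unitS (sfStep Lc (l + 1)) (smStep d Lc (l + 1)) (S (l + 1)))
    (G := fun p => (fun κ' u' => (sfStep Lc l * smStep d Lc l)⁻¹ • unitS (sfStep Lc l) (smStep d Lc l) (fun κ' u' => (cH l)⁻¹ • ((((1 : ℝ) + 1) / 2) • (comp (S l κ' u') (diagK (ξ • ∑ v ∈ box (d + 1) Lc, legInd (toSite r) ((Lc : ℤ) • p + toSite v))) - comp (diagK (ξ • ∑ v ∈ box (d + 1) Lc, legInd (toSite r) ((Lc : ℤ) • p + toSite v))) (S l κ' u')) + (((1 : ℝ) - 1) / 2) • R l p κ' u')) κ' u'))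
    (G' := fun p => (fun κ' u' => (sfStep Lc (l + 1) * smStep d Lc (l + 1))⁻¹ • unitS (sfStep Lc (l + 1)) (smStep d Lc (l + 1)) (fun κ' u' => (cH (l + 1))⁻¹ • ((((1 : ℝ) + 1) / 2) • (comp (S (l + 1) κ' u') (diagK (ξ • ∑ v ∈ box (d + 1) Lc, legInd (toSite r) ((Lc : ℤ) • p + toSite v))) - comp (diagK (ξ • ∑ v ∈ box (d + 1) Lc, legInd (toSite r) ((Lc : ℤ) • p + toSite v))) (S (l + 1) κ' u')) + (((1 : ℝ) - 1) / 2) • R (l + 1) p κ' u')) κ' u'))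
    (G₂ := fun p => (fun κ u => (sfStep Lc l * smStep d Lc l)⁻¹ • unitS (sfStep Lc l) (smStep d Lc l) (fun κ u => (cH l)⁻¹ • ((((1 : ℝ) + 1) / 2) • (comp (S l κ u) (diagK (ξ • ∑ v ∈ box (d + 1) Lc, legInd (toSite r) ((Lc : ℤ) • p + toSite v))) - comp (diagK (ξ • ∑ v ∈ box (d + 1) Lc, legInd (toSite r) ((Lc : ℤ) • p + toSite v))) (S l κ u)) + (((1 : ℝ) - 1) / 2) • R'' l p κ u)) κ u))
    (G₂' := fun p => (fun κ u => (sfStep Lc (l + 1) * smStep d Lc (l + 1))⁻¹ • unitS (sfStep Lc (l + 1)) (smStep d Lc (l + 1)) (fun κ u => (cH (l + 1))⁻¹ • ((((1 : ℝ) + 1) / 2) • (comp (S (l + 1) κ u) (diagK (ξ • ∑ v ∈ box (d + 1) Lc, legInd (toSite r) ((Lc : ℤ) • p + toSite v))) - comp (diagK (ξ • ∑ v ∈ box (d + 1) Lc, legInd (toSite r) ((Lc : ℤ) • p + toSite v))) (S (l + 1) κ u)) + (((1 : ℝ) - 1) / 2) • R'' (l + 1) p κ u)) κ u))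
    (c₀ := (sfStep Lc l * smStep d Lc l)⁻¹ * (cH l)⁻¹)
    (g := fun p => ξ • ∑ v ∈ box (d + 1) Lc, legInd (toSite r) ((Lc : ℤ) • p + toSite v))
    hLc (hG l) (hG (l + 1)) (hGall l 1) hδ (hS l) (hS (l + 1)) (hSall l 1) hδs
    (fun p κ u x z a b => evenLetterTable_eq_commFactor (S := S l) (X := fun p => diagK (ξ • ∑ v ∈ box (d + 1) Lc, legInd (toSite r) ((Lc : ℤ) • p + toSite v)))
      (g := fun p => ξ • ∑ v ∈ box (d + 1) Lc, legInd (toSite r) ((Lc : ℤ) • p + toSite v)) (fun p => rfl) (sfStep Lc l) (smStep d Lc l) (cH l) (R l) p κ u x z a b)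
    (fun p κ u x z a b => by
      rw [evenLetterTable_eq_commFactor (S := S (l + 1)) (X := fun p => diagK (ξ • ∑ v ∈ box (d + 1) Lc, legInd (toSite r) ((Lc : ℤ) • p + toSite v)))
        (g := fun p => ξ • ∑ v ∈ box (d + 1) Lc, legInd (toSite r) ((Lc : ℤ) • p + toSite v)) (fun p => rfl) (sfStep Lc (l + 1)) (smStep d Lc (l + 1)) (cH (l + 1)) (R (l + 1)) p κ u x z a b, hq l])
    (fun p κ u x z a b => evenLetterTable_eq_commFactor (S := S l) (X := fun p => diagK (ξ • ∑ v ∈ box (d + 1) Lc, legInd (toSite r) ((Lc : ℤ) • p + toSite v)))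
      (g := fun p => ξ • ∑ v ∈ box (d + 1) Lc, legInd (toSite r) ((Lc : ℤ) • p + toSite v)) (fun p => rfl) (sfStep Lc l) (smStep d Lc l) (cH l) (R'' l) p κ u x z a b)
    (fun p κ u x z a b => by
      rw [evenLetterTable_eq_commFactor (S := S (l + 1)) (X := fun p => diagK (ξ • ∑ v ∈ box (d + 1) Lc, legInd (toSite r) ((Lc : ℤ) • p + toSite v)))
        (g := fun p => ξ • ∑ v ∈ box (d + 1) Lc, legInd (toSite r) ((Lc : ℤ) • p + toSite v)) (fun p => rfl) (sfStep Lc (l + 1)) (smStep d Lc (l + 1)) (cH (l + 1)) (R'' (l + 1)) p κ u x z a b, hq l])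
    (fun p z b => abs_blockLegInd_smul_le ξ (toSite r) p z b) (fun p z b hh => blockLegInd_smul_support hr ξ p z b hh) cout


omit [NeZero Lc] in
/-- NOT IN PRINT; OUR BOOKKEEPING — A SOCKET ([folklore] composition: `driftRows_level_smul` level by level, then `|q_l| ≤ c₀` (`hcH`) and the two geometric rates merged at
`max θK θS`; generic `d`, in-block root `r`, `1 ≤ Lc`; ANY families `K`, `S`).  **THE DRIFT ROWS `hEd₁ ∕ hEd₂` AT `ε = 1` FOR ALL LEVELS WITH ONE `(CEd, θE, δE)`**: from the
kernels' uniform AND Cauchy unit rows `hG ∕ hGall`, the tables' uniform AND Cauchy unit rows `hS ∕ hSall`, and the two scalar rows `hcH : |(sf_l·sm_l)⁻¹·(cH l)⁻¹| ≤ c₀`,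
`hq : (sf_{l+1}·sm_{l+1})⁻¹·(cH (l+1))⁻¹ = (sf_l·sm_l)⁻¹·(cH l)⁻¹`, for ANY residual letters `R l`, `R″ l` (factor `(1 − 1)∕2 = 0`): `∃ CEd θE δE, 0 ≤ θE < 1 ∧ 0 < δE ∧ ∀ l,
hEd₁(l) ∧ hEd₂(l)` with rate `CEd·θE^l` — the binders `hEd` of MY `CombSlavedDivRowsOfWardLetters` at `ε = 1` (for `K := GcombSh Lc`).  road-P2 g45's
`exists_evenRowsDrift_uniform_of_rows` is the instance `K := coDressKBmAt ρ Lc ∘ KInvStep Lc`, `S := SpureRecAt … ρ …`, `ξ := ½`.  Asserts NO bound beyond the displayed rows;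
NOTHING of `hcelld` ∕ `hcell` ∕ (Q-L) ∕ (C) discharged. -/
theorem exists_evenRowsDrift_uniform_of_rows_smul (hLc : 1 ≤ Lc) (hr : r ∈ box (d + 1) Lc) (ξ cout : ℝ) (cH : ℕ → ℝ) {c₀ : ℝ}
    (hcH : ∀ l, |(sfStep Lc l * smStep d Lc l)⁻¹ * (cH l)⁻¹| ≤ c₀)
    (hq : ∀ l, (sfStep Lc (l + 1) * smStep d Lc (l + 1))⁻¹ * (cH (l + 1))⁻¹ = (sfStep Lc l * smStep d Lc l)⁻¹ * (cH l)⁻¹)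
    {K : ℕ → MKer (d + 1) (Fib d)} {C cK θK δ : ℝ}
    (hG : ∀ j, Decays (unitK (sfStep Lc j) (smStep d Lc j) (K j)) C δ)
    (hGall : ∀ k j, Decays (unitK (sfStep Lc (k + j)) (smStep d Lc (k + j)) (K (k + j))
        - unitK (sfStep Lc k) (smStep d Lc k) (K k)) (cK * θK ^ k) δ)
    (hδ : 0 < δ) (hθK0 : 0 ≤ θK) (hθK1 : θK < 1)
    {S : ℕ → Fin (d + 1) → (Fin (d + 1) → ℤ) → MKer (d + 1) (Fib d)}
    {Cs cS θS δs : ℝ} (hS : ∀ j, LocStencil (unitS (sfStep Lc j) (smStep d Lc j) (S j)) Cs δs)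
    (hSall : ∀ k j, LocStencil (unitS (sfStep Lc (k + j)) (smStep d Lc (k + j)) (S (k + j))
        - unitS (sfStep Lc k) (smStep d Lc k) (S k)) (cS * θS ^ k) δs)
    (hδs : 0 < δs) (hθS0 : 0 ≤ θS) (hθS1 : θS < 1)
    (R R'' : ℕ → (Fin (d + 1) → ℤ) → Fin (d + 1) → (Fin (d + 1) → ℤ) → MKer (d + 1) (Fib d)) :
    ∃ CEd θE δE : ℝ, 0 ≤ θE ∧ θE < 1 ∧ 0 < δE ∧ ∀ l,
      LocStencil₂ (fun (_ : Fin (d + 1)) (p : Fin (d + 1) → ℤ) (κ' : Fin (d + 1)) (u' : Fin (d + 1) → ℤ) =>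
            cout • (e3OfK Lc (unitK (sfStep Lc (l + 1)) (smStep d Lc (l + 1)) (K (l + 1)))
                (fun κ' u' => (sfStep Lc (l + 1) * smStep d Lc (l + 1))⁻¹ • unitS (sfStep Lc (l + 1)) (smStep d Lc (l + 1))
                  (fun κ' u' => (cH (l + 1))⁻¹ • ((((1 : ℝ) + 1) / 2) • (comp (S (l + 1) κ' u')
                      (diagK (ξ • ∑ v ∈ box (d + 1) Lc, legInd (toSite r) ((Lc : ℤ) • p + toSite v)))
                    - comp (diagK (ξ • ∑ v ∈ box (d + 1) Lc, legInd (toSite r) ((Lc : ℤ) • p + toSite v)))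
                      (S (l + 1) κ' u')) + (((1 : ℝ) - 1) / 2) • R (l + 1) p κ' u')) κ' u') κ' u'
              + e3OfK Lc (unitK (sfStep Lc (l + 1)) (smStep d Lc (l + 1)) (K (l + 1)))
                (fun κ u => (sfStep Lc (l + 1) * smStep d Lc (l + 1))⁻¹ • unitS (sfStep Lc (l + 1)) (smStep d Lc (l + 1))
                  (fun κ u => (cH (l + 1))⁻¹ • ((((1 : ℝ) + 1) / 2) • (comp (S (l + 1) κ u)
                      (diagK (ξ • ∑ v ∈ box (d + 1) Lc, legInd (toSite r) ((Lc : ℤ) • p + toSite v)))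
                    - comp (diagK (ξ • ∑ v ∈ box (d + 1) Lc, legInd (toSite r) ((Lc : ℤ) • p + toSite v)))
                      (S (l + 1) κ u)) + (((1 : ℝ) - 1) / 2) • R'' (l + 1) p κ u)) κ u) κ' u')
        - (cout • (e3OfK Lc (unitK (sfStep Lc l) (smStep d Lc l) (K l))
              (fun κ' u' => (sfStep Lc l * smStep d Lc l)⁻¹ • unitS (sfStep Lc l) (smStep d Lc l)
                (fun κ' u' => (cH l)⁻¹ • ((((1 : ℝ) + 1) / 2) • (comp (S l κ' u')
                    (diagK (ξ • ∑ v ∈ box (d + 1) Lc, legInd (toSite r) ((Lc : ℤ) • p + toSite v)))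
                  - comp (diagK (ξ • ∑ v ∈ box (d + 1) Lc, legInd (toSite r) ((Lc : ℤ) • p + toSite v)))
                    (S l κ' u')) + (((1 : ℝ) - 1) / 2) • R l p κ' u')) κ' u') κ' u'
            + e3OfK Lc (unitK (sfStep Lc l) (smStep d Lc l) (K l))
              (fun κ u => (sfStep Lc l * smStep d Lc l)⁻¹ • unitS (sfStep Lc l) (smStep d Lc l)
                (fun κ u => (cH l)⁻¹ • ((((1 : ℝ) + 1) / 2) • (comp (S l κ u)
                    (diagK (ξ • ∑ v ∈ box (d + 1) Lc, legInd (toSite r) ((Lc : ℤ) • p + toSite v)))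
                  - comp (diagK (ξ • ∑ v ∈ box (d + 1) Lc, legInd (toSite r) ((Lc : ℤ) • p + toSite v)))
                    (S l κ u)) + (((1 : ℝ) - 1) / 2) • R'' l p κ u)) κ u) κ' u'))) (CEd * θE ^ l) δE ∧
      LocStencil₂ (fun (κ : Fin (d + 1)) (u : Fin (d + 1) → ℤ) (_ : Fin (d + 1)) (p : Fin (d + 1) → ℤ) =>
            cout • (e3OfK Lc (unitK (sfStep Lc (l + 1)) (smStep d Lc (l + 1)) (K (l + 1)))
                (fun κ' u' => (sfStep Lc (l + 1) * smStep d Lc (l + 1))⁻¹ • unitS (sfStep Lc (l + 1)) (smStep d Lc (l + 1))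
                  (fun κ' u' => (cH (l + 1))⁻¹ • ((((1 : ℝ) + 1) / 2) • (comp (S (l + 1) κ' u')
                      (diagK (ξ • ∑ v ∈ box (d + 1) Lc, legInd (toSite r) ((Lc : ℤ) • p + toSite v)))
                    - comp (diagK (ξ • ∑ v ∈ box (d + 1) Lc, legInd (toSite r) ((Lc : ℤ) • p + toSite v)))
                      (S (l + 1) κ' u')) + (((1 : ℝ) - 1) / 2) • R (l + 1) p κ' u')) κ' u') κ u
              + e3OfK Lc (unitK (sfStep Lc (l + 1)) (smStep d Lc (l + 1)) (K (l + 1)))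
                (fun κ u => (sfStep Lc (l + 1) * smStep d Lc (l + 1))⁻¹ • unitS (sfStep Lc (l + 1)) (smStep d Lc (l + 1))
                  (fun κ u => (cH (l + 1))⁻¹ • ((((1 : ℝ) + 1) / 2) • (comp (S (l + 1) κ u)
                      (diagK (ξ • ∑ v ∈ box (d + 1) Lc, legInd (toSite r) ((Lc : ℤ) • p + toSite v)))
                    - comp (diagK (ξ • ∑ v ∈ box (d + 1) Lc, legInd (toSite r) ((Lc : ℤ) • p + toSite v)))
                      (S (l + 1) κ u)) + (((1 : ℝ) - 1) / 2) • R'' (l + 1) p κ u)) κ u) κ u)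
        - (cout • (e3OfK Lc (unitK (sfStep Lc l) (smStep d Lc l) (K l))
              (fun κ' u' => (sfStep Lc l * smStep d Lc l)⁻¹ • unitS (sfStep Lc l) (smStep d Lc l)
                (fun κ' u' => (cH l)⁻¹ • ((((1 : ℝ) + 1) / 2) • (comp (S l κ' u')
                    (diagK (ξ • ∑ v ∈ box (d + 1) Lc, legInd (toSite r) ((Lc : ℤ) • p + toSite v)))
                  - comp (diagK (ξ • ∑ v ∈ box (d + 1) Lc, legInd (toSite r) ((Lc : ℤ) • p + toSite v)))
                    (S l κ' u')) + (((1 : ℝ) - 1) / 2) • R l p κ' u')) κ' u') κ u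
            + e3OfK Lc (unitK (sfStep Lc l) (smStep d Lc l) (K l))
              (fun κ u => (sfStep Lc l * smStep d Lc l)⁻¹ • unitS (sfStep Lc l) (smStep d Lc l)
                (fun κ u => (cH l)⁻¹ • ((((1 : ℝ) + 1) / 2) • (comp (S l κ u)
                    (diagK (ξ • ∑ v ∈ box (d + 1) Lc, legInd (toSite r) ((Lc : ℤ) • p + toSite v)))
                  - comp (diagK (ξ • ∑ v ∈ box (d + 1) Lc, legInd (toSite r) ((Lc : ℤ) • p + toSite v)))
                    (S l κ u)) + (((1 : ℝ) - 1) / 2) • R'' l p κ u)) κ u) κ u))) (CEd * θE ^ l) δE   := by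
  have hC : 0 ≤ C := (hG 0).nonneg (Sum.inl 0)
  have hcK : 0 ≤ cK := by simpa using (hGall 0 0).nonneg (Sum.inl 0)
  have hCs : 0 ≤ Cs := ((hS 0) 0 0).nonneg (Sum.inl 0)
  have hcS : 0 ≤ cS := by simpa using ((hSall 0 0) 0 0).nonneg (Sum.inl 0)
  have hc₀ : 0 ≤ c₀ := (abs_nonneg _).trans (hcH 0)
  have hm : 0 < min δs δ / 2 := half_pos (lt_min hδs hδ)
  have hZ0 : 0 ≤ Zl (d + 1) (min δs δ / 2) := Zl_nonneg hm
  have hZ1 : 0 ≤ Zl (d + 1) (min δs δ / 2 / 2 - min δs δ / 2 / 4) := Zl_nonneg (by linarith)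
  have hZ2 : 0 ≤ Zl (d + 1) (min δs δ / 2 / 4 - min δs δ / 2 / 8) := Zl_nonneg (by linarith)
  have hΨ0 : 0 ≤ ((Fintype.card (Fib d) : ℝ) * (Fintype.card (Fib d) : ℝ)
      * (2 * (|ξ| * (box (d + 1) Lc).card) * (((d + 1 : ℕ) : ℝ) * Zl (d + 1) (min δs δ / 2)) * Real.exp (min δs δ / 2 / 2 * (2 * (((d + 1 : ℕ) : ℝ) * Lc))))
      * Zl (d + 1) (min δs δ / 2 / 2 - min δs δ / 2 / 4) * Zl (d + 1) (min δs δ / 2 / 4 - min δs δ / 2 / 8)) := by positivity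
  refine ⟨2 * |cout| * c₀ * (3 * cK * C * C * Cs + C * C * C * cS) * ((Fintype.card (Fib d) : ℝ) * (Fintype.card (Fib d) : ℝ)
      * (2 * (|ξ| * (box (d + 1) Lc).card) * (((d + 1 : ℕ) : ℝ) * Zl (d + 1) (min δs δ / 2)) * Real.exp (min δs δ / 2 / 2 * (2 * (((d + 1 : ℕ) : ℝ) * Lc))))
      * Zl (d + 1) (min δs δ / 2 / 2 - min δs δ / 2 / 4) * Zl (d + 1) (min δs δ / 2 / 4 - min δs δ / 2 / 8)),
    max θK θS, min δs δ / 2 / 8, hθK0.trans (le_max_left _ _), max_lt hθK1 hθS1, by positivity, fun l => ?_⟩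
  -- the level-`l` constant is monotone in `|q_l| ≤ c₀` and in the two rates `θK, θS ≤ max θK θS`
  have hq' := hcH l
  have hθl : 0 ≤ max θK θS := hθK0.trans (le_max_left _ _)
  have t1 : θK ^ l ≤ (max θK θS) ^ l := pow_le_pow_left₀ hθK0 (le_max_left _ _) l
  have t2 : θS ^ l ≤ (max θK θS) ^ l := pow_le_pow_left₀ hθS0 (le_max_right _ _) l
  have u1 : cK * θK ^ l ≤ cK * (max θK θS) ^ l := mul_le_mul_of_nonneg_left t1 hcK
  have u2 : cS * θS ^ l ≤ cS * (max θK θS) ^ l := mul_le_mul_of_nonneg_left t2 hcS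
  have hCCC : 0 ≤ C * C * C := mul_nonneg (mul_nonneg hC hC) hC
  have hA : 3 * (cK * θK ^ l) * C * C * Cs + C * C * C * (cS * θS ^ l)
      ≤ 3 * (cK * (max θK θS) ^ l) * C * C * Cs + C * C * C * (cS * (max θK θS) ^ l) :=
    add_le_add (mul_le_mul_of_nonneg_right (mul_le_mul_of_nonneg_right (mul_le_mul_of_nonneg_right
      (mul_le_mul_of_nonneg_left u1 (by norm_num)) hC) hC) hCs) (mul_le_mul_of_nonneg_left u2 hCCC)
  have hθKl : 0 ≤ θK ^ l := pow_nonneg hθK0 l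
  have hθSl : 0 ≤ θS ^ l := pow_nonneg hθS0 l
  have hA0 : 0 ≤ 3 * (cK * θK ^ l) * C * C * Cs + C * C * C * (cS * θS ^ l) :=
    add_nonneg (mul_nonneg (mul_nonneg (mul_nonneg (mul_nonneg (by norm_num) (mul_nonneg hcK hθKl)) hC) hC) hCs)
      (mul_nonneg hCCC (mul_nonneg hcS hθSl))
  have h2c : 0 ≤ 2 * |cout| := mul_nonneg (by norm_num) (abs_nonneg _)
  have h2c0 : 0 ≤ 2 * |cout| * c₀ := mul_nonneg h2c hc₀
  have step : 2 * |cout| * |(sfStep Lc l * smStep d Lc l)⁻¹ * (cH l)⁻¹| * (3 * (cK * θK ^ l) * C * C * Cs + C * C * C * (cS * θS ^ l))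
      ≤ 2 * |cout| * c₀ * (3 * (cK * (max θK θS) ^ l) * C * C * Cs + C * C * C * (cS * (max θK θS) ^ l)) :=
    mul_le_mul (mul_le_mul_of_nonneg_left hq' h2c) hA hA0 h2c0
  have hle : (2 * |cout| * |(sfStep Lc l * smStep d Lc l)⁻¹ * (cH l)⁻¹| * (3 * (cK * θK ^ l) * C * C * Cs + C * C * C * (cS * θS ^ l))
      * ((Fintype.card (Fib d) : ℝ) * (Fintype.card (Fib d) : ℝ)
      * (2 * (|ξ| * (box (d + 1) Lc).card) * (((d + 1 : ℕ) : ℝ) * Zl (d + 1) (min δs δ / 2)) * Real.exp (min δs δ / 2 / 2 * (2 * (((d + 1 : ℕ) : ℝ) * Lc))))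
      * Zl (d + 1) (min δs δ / 2 / 2 - min δs δ / 2 / 4) * Zl (d + 1) (min δs δ / 2 / 4 - min δs δ / 2 / 8)))
      ≤ (2 * |cout| * c₀ * (3 * cK * C * C * Cs + C * C * C * cS) * ((Fintype.card (Fib d) : ℝ) * (Fintype.card (Fib d) : ℝ)
      * (2 * (|ξ| * (box (d + 1) Lc).card) * (((d + 1 : ℕ) : ℝ) * Zl (d + 1) (min δs δ / 2)) * Real.exp (min δs δ / 2 / 2 * (2 * (((d + 1 : ℕ) : ℝ) * Lc))))
      * Zl (d + 1) (min δs δ / 2 / 2 - min δs δ / 2 / 4) * Zl (d + 1) (min δs δ / 2 / 4 - min δs δ / 2 / 8))) * (max θK θS) ^ l :=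
    calc (2 * |cout| * |(sfStep Lc l * smStep d Lc l)⁻¹ * (cH l)⁻¹| * (3 * (cK * θK ^ l) * C * C * Cs + C * C * C * (cS * θS ^ l))
      * ((Fintype.card (Fib d) : ℝ) * (Fintype.card (Fib d) : ℝ)
      * (2 * (|ξ| * (box (d + 1) Lc).card) * (((d + 1 : ℕ) : ℝ) * Zl (d + 1) (min δs δ / 2)) * Real.exp (min δs δ / 2 / 2 * (2 * (((d + 1 : ℕ) : ℝ) * Lc))))
      * Zl (d + 1) (min δs δ / 2 / 2 - min δs δ / 2 / 4) * Zl (d + 1) (min δs δ / 2 / 4 - min δs δ / 2 / 8)))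
        ≤ 2 * |cout| * c₀ * (3 * (cK * (max θK θS) ^ l) * C * C * Cs + C * C * C * (cS * (max θK θS) ^ l))
      * ((Fintype.card (Fib d) : ℝ) * (Fintype.card (Fib d) : ℝ)
      * (2 * (|ξ| * (box (d + 1) Lc).card) * (((d + 1 : ℕ) : ℝ) * Zl (d + 1) (min δs δ / 2)) * Real.exp (min δs δ / 2 / 2 * (2 * (((d + 1 : ℕ) : ℝ) * Lc))))
      * Zl (d + 1) (min δs δ / 2 / 2 - min δs δ / 2 / 4) * Zl (d + 1) (min δs δ / 2 / 4 - min δs δ / 2 / 8)) := mul_le_mul_of_nonneg_right step hΨ0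
      _ = (2 * |cout| * c₀ * (3 * cK * C * C * Cs + C * C * C * cS) * ((Fintype.card (Fib d) : ℝ) * (Fintype.card (Fib d) : ℝ)
      * (2 * (|ξ| * (box (d + 1) Lc).card) * (((d + 1 : ℕ) : ℝ) * Zl (d + 1) (min δs δ / 2)) * Real.exp (min δs δ / 2 / 2 * (2 * (((d + 1 : ℕ) : ℝ) * Lc))))
      * Zl (d + 1) (min δs δ / 2 / 2 - min δs δ / 2 / 4) * Zl (d + 1) (min δs δ / 2 / 4 - min δs δ / 2 / 8))) * (max θK θS) ^ l := by ring
  have h := driftRows_level_smul hLc hr ξ cout cH hq hG hGall hδ hS hSall hδs R R'' l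
  exact ⟨locStencil₂_le_mono h.1 hle le_rfl, locStencil₂_le_mono h.2 hle le_rfl⟩

/-! ## §2 `d = 3`, `Lc ≥ 2`, an1's record: the drift rows for all levels at the comb-chart data, modulo the S-slot rows of `ScombOf` and the two scalar rows -/

/-- NOT IN PRINT; OUR BOOKKEEPING ([folklore] composition: §1 ∘ leaf-02 g77's (III′) K-slot `KSlotCombChart.kSlotCombSh_holds` (uniform AND Cauchy unit rows of the comb-chart
kernels, hypothesis-free) ∘ leaf-02 g79's `CombSpureRowsOfSRows.exists_spureCombOf_rows_three_of_scombOf_rows` («S′Shape» ∧ «S′Drift» ⟸ (hS, hSall) of `ScombOf`)).  **THE DRIFT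
ROWS `hEd₁ ∕ hEd₂` AT `d = 3` FOR THE COMB-CHART DATA AT an1's RECORD `symTablesAn1S2 3 Lc cΛt`, ALL LEVELS WITH ONE `(CEd, θE, δE)`, MODULO THE S-SLOT ROWS (hS, hSall) OF
`ScombOf` AND THE SCALAR ROWS `hcH`, `hq` ONLY** (`2 ≤ Lc`, every `cΛt cE cVH cΛ ξ cout`, every in-block root `r`, any `R l`, `R″ l`, `cH l`).  The (III′) twin of road-P2's
`exists_evenRowsDrift_uniform_three` ((hS, hSall) there = the OWNER g22's chart-(II) S-slot END; here the S′-campaign's rows, DISPLAYED).  Discharges NOTHING of `hcelld` ∕ (Q-L)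
∕ (C) ∕ the S-slot; NEVER «G-an2-4 closed» as (CONV-C). -/
theorem exists_comb_evenRowsDrift_uniform_three (hLc : 2 ≤ Lc) (cΛt cE cVH cΛ ξ cout : ℝ) {r : Fin (3 + 1) → ℕ} (hr : r ∈ box (3 + 1) Lc)
    (cH : ℕ → ℝ) {c₀ : ℝ} (hcH : ∀ l, |(sfStep Lc l * smStep 3 Lc l)⁻¹ * (cH l)⁻¹| ≤ c₀)
    (hq : ∀ l, (sfStep Lc (l + 1) * smStep 3 Lc (l + 1))⁻¹ * (cH (l + 1))⁻¹ = (sfStep Lc l * smStep 3 Lc l)⁻¹ * (cH l)⁻¹) {Cs cS θS δS : ℝ}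
    (hS : ∀ j, LocStencil (unitS (sfStep Lc j) (smStep 3 Lc j) (ScombOf (symTablesAn1S2 3 Lc cΛt) cE cVH cΛ j)) Cs δS)
    (hSall : ∀ k j, LocStencil (unitS (sfStep Lc (k + j)) (smStep 3 Lc (k + j)) (ScombOf (symTablesAn1S2 3 Lc cΛt) cE cVH cΛ (k + j)) -
      unitS (sfStep Lc k) (smStep 3 Lc k) (ScombOf (symTablesAn1S2 3 Lc cΛt) cE cVH cΛ k)) (cS * θS ^ k) δS)
    (hδS : 0 < δS) (hθS0 : 0 ≤ θS) (hθS1 : θS < 1)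
    (R R'' : ℕ → (Fin (3 + 1) → ℤ) → Fin (3 + 1) → (Fin (3 + 1) → ℤ) → MKer (3 + 1) (Fib 3)) :
    ∃ CEd θE δE : ℝ, 0 ≤ θE ∧ θE < 1 ∧ 0 < δE ∧ ∀ l,
      LocStencil₂ (fun (_ : Fin (3 + 1)) (p : Fin (3 + 1) → ℤ) (κ' : Fin (3 + 1)) (u' : Fin (3 + 1) → ℤ) =>
            cout • (e3OfK Lc (unitK (sfStep Lc (l + 1)) (smStep 3 Lc (l + 1)) (GcombSh (d := 3) Lc (l + 1)))
                (fun κ' u' => (sfStep Lc (l + 1) * smStep 3 Lc (l + 1))⁻¹ • unitS (sfStep Lc (l + 1)) (smStep 3 Lc (l + 1))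
                  (fun κ' u' => (cH (l + 1))⁻¹ • ((((1 : ℝ) + 1) / 2) • (comp (SpureCombOf (symTablesAn1S2 3 Lc cΛt) cE cVH cΛ (l + 1) κ' u')
                      (diagK (ξ • ∑ v ∈ box (3 + 1) Lc, legInd (toSite r) ((Lc : ℤ) • p + toSite v)))
                    - comp (diagK (ξ • ∑ v ∈ box (3 + 1) Lc, legInd (toSite r) ((Lc : ℤ) • p + toSite v)))
                      (SpureCombOf (symTablesAn1S2 3 Lc cΛt) cE cVH cΛ (l + 1) κ' u')) + (((1 : ℝ) - 1) / 2) • R (l + 1) p κ' u')) κ' u') κ' u'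
              + e3OfK Lc (unitK (sfStep Lc (l + 1)) (smStep 3 Lc (l + 1)) (GcombSh (d := 3) Lc (l + 1)))
                (fun κ u => (sfStep Lc (l + 1) * smStep 3 Lc (l + 1))⁻¹ • unitS (sfStep Lc (l + 1)) (smStep 3 Lc (l + 1))
                  (fun κ u => (cH (l + 1))⁻¹ • ((((1 : ℝ) + 1) / 2) • (comp (SpureCombOf (symTablesAn1S2 3 Lc cΛt) cE cVH cΛ (l + 1) κ u)
                      (diagK (ξ • ∑ v ∈ box (3 + 1) Lc, legInd (toSite r) ((Lc : ℤ) • p + toSite v)))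
                    - comp (diagK (ξ • ∑ v ∈ box (3 + 1) Lc, legInd (toSite r) ((Lc : ℤ) • p + toSite v)))
                      (SpureCombOf (symTablesAn1S2 3 Lc cΛt) cE cVH cΛ (l + 1) κ u)) + (((1 : ℝ) - 1) / 2) • R'' (l + 1) p κ u)) κ u) κ' u')
        - (cout • (e3OfK Lc (unitK (sfStep Lc l) (smStep 3 Lc l) (GcombSh (d := 3) Lc l))
              (fun κ' u' => (sfStep Lc l * smStep 3 Lc l)⁻¹ • unitS (sfStep Lc l) (smStep 3 Lc l)
                (fun κ' u' => (cH l)⁻¹ • ((((1 : ℝ) + 1) / 2) • (comp (SpureCombOf (symTablesAn1S2 3 Lc cΛt) cE cVH cΛ l κ' u')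
                    (diagK (ξ • ∑ v ∈ box (3 + 1) Lc, legInd (toSite r) ((Lc : ℤ) • p + toSite v)))
                  - comp (diagK (ξ • ∑ v ∈ box (3 + 1) Lc, legInd (toSite r) ((Lc : ℤ) • p + toSite v)))
                    (SpureCombOf (symTablesAn1S2 3 Lc cΛt) cE cVH cΛ l κ' u')) + (((1 : ℝ) - 1) / 2) • R l p κ' u')) κ' u') κ' u'
            + e3OfK Lc (unitK (sfStep Lc l) (smStep 3 Lc l) (GcombSh (d := 3) Lc l))
              (fun κ u => (sfStep Lc l * smStep 3 Lc l)⁻¹ • unitS (sfStep Lc l) (smStep 3 Lc l)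
                (fun κ u => (cH l)⁻¹ • ((((1 : ℝ) + 1) / 2) • (comp (SpureCombOf (symTablesAn1S2 3 Lc cΛt) cE cVH cΛ l κ u)
                    (diagK (ξ • ∑ v ∈ box (3 + 1) Lc, legInd (toSite r) ((Lc : ℤ) • p + toSite v)))
                  - comp (diagK (ξ • ∑ v ∈ box (3 + 1) Lc, legInd (toSite r) ((Lc : ℤ) • p + toSite v)))
                    (SpureCombOf (symTablesAn1S2 3 Lc cΛt) cE cVH cΛ l κ u)) + (((1 : ℝ) - 1) / 2) • R'' l p κ u)) κ u) κ' u'))) (CEd * θE ^ l) δE ∧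
      LocStencil₂ (fun (κ : Fin (3 + 1)) (u : Fin (3 + 1) → ℤ) (_ : Fin (3 + 1)) (p : Fin (3 + 1) → ℤ) =>
            cout • (e3OfK Lc (unitK (sfStep Lc (l + 1)) (smStep 3 Lc (l + 1)) (GcombSh (d := 3) Lc (l + 1)))
                (fun κ' u' => (sfStep Lc (l + 1) * smStep 3 Lc (l + 1))⁻¹ • unitS (sfStep Lc (l + 1)) (smStep 3 Lc (l + 1))
                  (fun κ' u' => (cH (l + 1))⁻¹ • ((((1 : ℝ) + 1) / 2) • (comp (SpureCombOf (symTablesAn1S2 3 Lc cΛt) cE cVH cΛ (l + 1) κ' u')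
                      (diagK (ξ • ∑ v ∈ box (3 + 1) Lc, legInd (toSite r) ((Lc : ℤ) • p + toSite v)))
                    - comp (diagK (ξ • ∑ v ∈ box (3 + 1) Lc, legInd (toSite r) ((Lc : ℤ) • p + toSite v)))
                      (SpureCombOf (symTablesAn1S2 3 Lc cΛt) cE cVH cΛ (l + 1) κ' u')) + (((1 : ℝ) - 1) / 2) • R (l + 1) p κ' u')) κ' u') κ u
              + e3OfK Lc (unitK (sfStep Lc (l + 1)) (smStep 3 Lc (l + 1)) (GcombSh (d := 3) Lc (l + 1)))
                (fun κ u => (sfStep Lc (l + 1) * smStep 3 Lc (l + 1))⁻¹ • unitS (sfStep Lc (l + 1)) (smStep 3 Lc (l + 1))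
                  (fun κ u => (cH (l + 1))⁻¹ • ((((1 : ℝ) + 1) / 2) • (comp (SpureCombOf (symTablesAn1S2 3 Lc cΛt) cE cVH cΛ (l + 1) κ u)
                      (diagK (ξ • ∑ v ∈ box (3 + 1) Lc, legInd (toSite r) ((Lc : ℤ) • p + toSite v)))
                    - comp (diagK (ξ • ∑ v ∈ box (3 + 1) Lc, legInd (toSite r) ((Lc : ℤ) • p + toSite v)))
                      (SpureCombOf (symTablesAn1S2 3 Lc cΛt) cE cVH cΛ (l + 1) κ u)) + (((1 : ℝ) - 1) / 2) • R'' (l + 1) p κ u)) κ u) κ u)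
        - (cout • (e3OfK Lc (unitK (sfStep Lc l) (smStep 3 Lc l) (GcombSh (d := 3) Lc l))
              (fun κ' u' => (sfStep Lc l * smStep 3 Lc l)⁻¹ • unitS (sfStep Lc l) (smStep 3 Lc l)
                (fun κ' u' => (cH l)⁻¹ • ((((1 : ℝ) + 1) / 2) • (comp (SpureCombOf (symTablesAn1S2 3 Lc cΛt) cE cVH cΛ l κ' u')
                    (diagK (ξ • ∑ v ∈ box (3 + 1) Lc, legInd (toSite r) ((Lc : ℤ) • p + toSite v)))
                  - comp (diagK (ξ • ∑ v ∈ box (3 + 1) Lc, legInd (toSite r) ((Lc : ℤ) • p + toSite v)))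
                    (SpureCombOf (symTablesAn1S2 3 Lc cΛt) cE cVH cΛ l κ' u')) + (((1 : ℝ) - 1) / 2) • R l p κ' u')) κ' u') κ u
            + e3OfK Lc (unitK (sfStep Lc l) (smStep 3 Lc l) (GcombSh (d := 3) Lc l))
              (fun κ u => (sfStep Lc l * smStep 3 Lc l)⁻¹ • unitS (sfStep Lc l) (smStep 3 Lc l)
                (fun κ u => (cH l)⁻¹ • ((((1 : ℝ) + 1) / 2) • (comp (SpureCombOf (symTablesAn1S2 3 Lc cΛt) cE cVH cΛ l κ u)
                    (diagK (ξ • ∑ v ∈ box (3 + 1) Lc, legInd (toSite r) ((Lc : ℤ) • p + toSite v)))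
                  - comp (diagK (ξ • ∑ v ∈ box (3 + 1) Lc, legInd (toSite r) ((Lc : ℤ) • p + toSite v)))
                    (SpureCombOf (symTablesAn1S2 3 Lc cΛt) cE cVH cΛ l κ u)) + (((1 : ℝ) - 1) / 2) • R'' l p κ u)) κ u) κ u))) (CEd * θE ^ l) δE := by
  have hLc1 : 1 ≤ Lc := by omega
  obtain ⟨C, δK, cK, θK, hδK, hθK0, hθK1, hG, hGall⟩ := kSlotCombSh_holds (Lc := Lc) hLc
  obtain ⟨Cs', cS', θ', δ', hθ'0, hθ'1, hδ', hS', hS'all⟩ := exists_spureCombOf_rows_three_of_scombOf_rows hLc cΛt cE cVH cΛ hS hSall hδS hθS0 hθS1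
  exact exists_evenRowsDrift_uniform_of_rows_smul hLc1 hr ξ cout cH hcH hq hG hGall hδK hθK0 hθK1 hS' hS'all hδ' hθ'0 hθ'1 R R''

end Summit.QuantumFields.BalabanUV.Beta.GAN24.CombBlockCommutatorStepLetterDrift

end
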